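import Summits.ResolutionOfSingularities.ResolutionOfSingularities.Theorems.FrobeniusLadderFRationalResolutionFixedStratumNextRound
import Summits.ResolutionOfSingularities.ResolutionOfSingularities.Theorems.FrobeniusLadderFRationalResolutionFixedStratumNearby
import Summits.ResolutionOfSingularities.ResolutionOfSingularities.Theorems.FrobeniusLadderFRationalResolutionFixedStratumCentre
import Summits.ResolutionOfSingularities.ResolutionOfSingularities.Theorems.FrobeniusLadderFRationalResolutionChartAlgebraFixedPointDim
import HarnessLib

/-!
# Crux `FrobeniusLadder.FRationalResolution` (stmt-ResolutionOfSingularities-15317), line `redirect`,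
# stub `stub_diagonalizableQuotientResolution` — **the pointwise singular-locus description PROPAGATES to the charts
# of the round** (design C3 = the rank-2 stratum layer of the non-isolated case, L3-b: the hypothesis `hSing` of
# `…SingBlowupRound.exists_chart_of_singular_point` re-established for the chart algebra `C_h = C[(χ s)/χ(h)]` at the
# new fixed prime, from the bookkeeping outputs of `…SingBlowupRoundRoof.exists_chart_of_singular_point'`)

RING-LEVEL STATEMENT **`singular_iff_forall_mem_of_chart`**: base `(A, P, φ, 𝔭)`, chart algebra `(C, Q, χ)`, a finite
`s ⊆ Q ∖ ℤF_𝔭`, a chart `h` with vertex data `(v, x, c)`, `c ≥ 2`, the fixed prime `𝔓` of `C`; let `𝔔'` be ANY prime of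
`C_h` such that, at `𝔔₀ = 𝔔' ∩ C`: (a) `¬ regular C_{𝔔₀} ↔ I(𝔓, χ) ⊆ 𝔔₀` (the old description), (b) off the exceptional
divisor (`(χ s) ⊄ 𝔔₀`) regularity of `(C_h)_{𝔔'}` is that of `C_{𝔔₀}`, (c) the unit face `F_𝔭` stays units at
`𝔮' = 𝔔' ∩ A` and (d) `φ` is log regular at every prime below `𝔮'`. THEN `¬ regular (C_h)_{𝔔'} ↔ χ_h(Q_h ∖ ℤF_𝔭) ⊆ 𝔔'`.
Proof: off the divisor both sides fail ((a), (b), `s ⊆ Q ∖ ℤF_𝔭`); on it `I(𝔭, φ) ⊆ 𝔮'`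
(`…ChartAlgebraFixedPointDim.map_ideal_le_ideal`), the invariant RE-BASES at `𝔮'` (`…FixedStratumNearby`: `F_{𝔮'} = F_𝔭`,
`I(𝔮') = I(𝔭)`), and `…FixedStratumNextRound.exists_fixedPrime_package_of_stratum` AT `𝔮'` says the primes of `C_h` over
`𝔮'` are regular except THE fixed one, characterised by containing `χ_h(Q_h ∖ ℤF_𝔭)`.
* `forall_mem_iff_ideal_le` — `χ_h(Q_h ∖ ℤF_𝔭) ⊆ 𝔔' ↔ I(𝔔, χ_h) ⊆ 𝔔'` for the new fixed prime `𝔔`: the conclusion is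
  literally the next round's `hSing`.

Honest label: generic local algebra toward ONE leaf stub (no stub, crux or summit closed). No definitions, no named facts,
no sorry. [cite: Kato1994, Def. (2.1), (7.3), (10.1), (10.3)] [cite: Niziol2006, §4]
-/

noncomputable section

-- single-problem summit: the doubled namespace component is forced
set_option linter.dupNamespace false

open IsLocalRing Literature.AlgebraicGeometry.Resolution Literature.AlgebraicGeometry.Resolution.LogChart
open Summit.ResolutionOfSingularities.ResolutionOfSingularities.Theorems.FRationalResolution
open Summit.ResolutionOfSingularities.ResolutionOfSingularities.Theorems.FRationalResolution.ChartAlgebraFixedPoint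
open Summit.ResolutionOfSingularities.ResolutionOfSingularities.Theorems.FRationalResolution.ChartAlgebraTower
open Summit.ResolutionOfSingularities.ResolutionOfSingularities.Theorems.FRationalResolution.VertexChartBlowupCharts

namespace Summit.ResolutionOfSingularities.ResolutionOfSingularities.Theorems.FRationalResolution.SingBlowupRoundSing

universe u

variable {A : Type u} [CommRing A] [IsNoetherianRing A] {n : ℕ} {P : AddSubmonoid (Fin n → ℤ)}
  {φ : Multiplicative P →* A} {𝔭 : Ideal A} [𝔭.IsPrime] {C : Type u} [CommRing C] [Algebra A C]
  [IsNoetherianRing C] {Q : AddSubmonoid (Fin n → ℤ)} {χ : Multiplicative Q →* C}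
  {s : Set (Fin n → ℤ)} {h v x : Fin n → ℤ} {c : ℕ}

set_option maxHeartbeats 800000 in
/-- **The pointwise singular-locus description propagates to the chart of the round.** See the module docstring.
[cite: Kato1994, Def. (2.1), (7.3), (10.1), (10.3)] -/
theorem singular_iff_forall_mem_of_chart (hc : 2 ≤ c) (hs : s.Finite) (hP : P.FG)
    (hsat : ∀ (w : Fin n → ℤ) (k : ℕ), 0 < k → k • w ∈ P → w ∈ P)
    (hspanP : Submodule.span ℤ (P : Set (Fin n → ℤ)) = ⊤)
    (hrank : n - Module.finrank ℤ (Submodule.span ℤ (faceMonoid P φ 𝔭 : Set (Fin n → ℤ))) ≤ 2) (hPQ : P ≤ Q)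
    (hχ : ∀ p : P, χ (Multiplicative.ofAdd ⟨(p : Fin n → ℤ), hPQ p.2⟩) =
      algebraMap A C (φ (Multiplicative.ofAdd p)))
    (hgen : Algebra.adjoin A (Set.range χ) = ⊤)
    (hD : ∀ q ∈ Q, ∃ p ∈ P, q + p ∈ P)
    (hK : ∀ a : A, algebraMap A C a = 0 → ∃ p : P, φ (Multiplicative.ofAdd p) * a = 0)
    (hΩ : ∀ (K : Type u) [Field K] (g : A →+* K), (∀ p : P, g (φ (Multiplicative.ofAdd p)) ≠ 0) →
      ∃ ω : C →+* K, ω.comp (algebraMap A C) = g)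
    (hQfg : Q.FG) (hhQ : h ∈ Q)
    (hQh : ∀ w, w ∈ blowupChartMonoid Q {q : Q | (q : Fin n → ℤ) ∈ s} ⟨h, hhQ⟩ ↔
      ∃ g ∈ Submodule.span ℤ (faceMonoid P φ 𝔭 : Set (Fin n → ℤ)), ∃ m l : ℤ,
        0 ≤ m ∧ 0 ≤ m + (c : ℤ) * l ∧ w = g + m • v + l • x)
    (hind : ∀ g ∈ Submodule.span ℤ (faceMonoid P φ 𝔭 : Set (Fin n → ℤ)), ∀ m l : ℤ,
      g + m • v + l • x = 0 → m = 0 ∧ l = 0)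
    (hspan : ∀ w : Fin n → ℤ, ∃ g ∈ Submodule.span ℤ (faceMonoid P φ 𝔭 : Set (Fin n → ℤ)),
      ∃ m l : ℤ, w = g + m • v + l • x)
    (hsQ : s ⊆ Q) (hsL : ∀ h' ∈ s, h' ∉ Submodule.span ℤ (faceMonoid P φ 𝔭 : Set (Fin n → ℤ)))
    (hsgen : ∀ q ∈ Q, q ∉ Submodule.span ℤ (faceMonoid P φ 𝔭 : Set (Fin n → ℤ)) → ∃ h' ∈ s, q - h' ∈ Q)
    (𝔓 : Ideal C) [𝔓.IsPrime] (h𝔓A : 𝔓.comap (algebraMap A C) = 𝔭)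
    (h𝔓q : ∀ q : Q, (q : Fin n → ℤ) ∉ Submodule.span ℤ (faceMonoid P φ 𝔭 : Set (Fin n → ℤ)) →
      χ (Multiplicative.ofAdd q) ∈ 𝔓)
    (𝔔' : Ideal (blowupAlgebra (Ideal.span ((fun q : Q => χ (Multiplicative.ofAdd q)) ''
        {q : Q | (q : Fin n → ℤ) ∈ s})) (χ (Multiplicative.ofAdd ⟨h, hhQ⟩)))) [𝔔'.IsPrime]
    (hSing₀ : ¬ IsRegularLocalRing (Localization.AtPrime (𝔔'.comap (algebraMap C _))) ↔
      ideal Q χ 𝔓 ≤ 𝔔'.comap (algebraMap C _))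
    (hoff : ¬ Ideal.span ((fun q : Q => χ (Multiplicative.ofAdd q)) '' {q : Q | (q : Fin n → ℤ) ∈ s}) ≤
        𝔔'.comap (algebraMap C _) →
      (IsRegularLocalRing (Localization.AtPrime 𝔔') ↔
        IsRegularLocalRing (Localization.AtPrime (𝔔'.comap (algebraMap C _)))))
    (hFunit : ∀ w ∈ faceMonoid P φ 𝔭, val P φ w ∉ 𝔔'.comap (algebraMap A _))
    (hregY : ∀ (𝔮 : Ideal A) [𝔮.IsPrime], 𝔮 ≤ 𝔔'.comap (algebraMap A _) → IsLogRegularAt P φ 𝔮) :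
    ¬ IsRegularLocalRing (Localization.AtPrime 𝔔') ↔
      ∀ qq : blowupChartMonoid Q {q : Q | (q : Fin n → ℤ) ∈ s} ⟨h, hhQ⟩,
        (qq : Fin n → ℤ) ∉ Submodule.span ℤ (faceMonoid P φ 𝔭 : Set (Fin n → ℤ)) →
          blowupChart Q χ {q : Q | (q : Fin n → ℤ) ∈ s} ⟨h, hhQ⟩ (Multiplicative.ofAdd qq) ∈ 𝔔' := by
  classical
  haveI h𝔮'prime : (𝔔'.comap (algebraMap A (blowupAlgebra (Ideal.span ((fun q : Q => χ (Multiplicative.ofAdd q)) '' {q : Q | (q : Fin n → ℤ) ∈ s})) (χ (Multiplicative.ofAdd ⟨h, hhQ⟩))))).IsPrime := Ideal.IsPrime.comap _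
  have h𝔮'C : (𝔔'.comap (algebraMap C (blowupAlgebra (Ideal.span ((fun q : Q => χ (Multiplicative.ofAdd q)) '' {q : Q | (q : Fin n → ℤ) ∈ s})) (χ (Multiplicative.ofAdd ⟨h, hhQ⟩))))).comap (algebraMap A C) = 𝔔'.comap (algebraMap A (blowupAlgebra (Ideal.span ((fun q : Q => χ (Multiplicative.ofAdd q)) '' {q : Q | (q : Fin n → ℤ) ∈ s})) (χ (Multiplicative.ofAdd ⟨h, hhQ⟩)))) := by
    rw [Ideal.comap_comap, ← IsScalarTower.algebraMap_eq]
  haveI : IsNoetherianRing (blowupAlgebra (Ideal.span ((fun q : Q => χ (Multiplicative.ofAdd q)) '' {q : Q | (q : Fin n → ℤ) ∈ s})) (χ (Multiplicative.ofAdd ⟨h, hhQ⟩))) := isNoetherianRing_blowupAlgebra_of_isNoetherianRing _ _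
  have hJeq : Ideal.span ((fun q : Q => χ (Multiplicative.ofAdd q)) '' {q : Q | (q : Fin n → ℤ) ∈ s}) = ideal Q χ 𝔓 := FixedStratumCentre.span_chain_eq_ideal hPQ hχ hsQ hsL hsgen h𝔓A h𝔓q
  -- the chart extends `χ` on `Q`
  have hext : ∀ q : Q, blowupChart Q χ {q : Q | (q : Fin n → ℤ) ∈ s} ⟨h, hhQ⟩
      (Multiplicative.ofAdd ⟨(q : Fin n → ℤ), le_blowupChartMonoid Q {q : Q | (q : Fin n → ℤ) ∈ s} ⟨h, hhQ⟩ q.2⟩) =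
      algebraMap C _ (χ (Multiplicative.ofAdd q)) := fun q => blowupChart_of_mem Q χ {q : Q | (q : Fin n → ℤ) ∈ s} ⟨h, hhQ⟩ q
  by_cases hJ : Ideal.span ((fun q : Q => χ (Multiplicative.ofAdd q)) '' {q : Q | (q : Fin n → ℤ) ∈ s}) ≤ 𝔔'.comap (algebraMap C (blowupAlgebra (Ideal.span ((fun q : Q => χ (Multiplicative.ofAdd q)) '' {q : Q | (q : Fin n → ℤ) ∈ s})) (χ (Multiplicative.ofAdd ⟨h, hhQ⟩))))
  · -- ON the exceptional divisor: `I(𝔭) ⊆ 𝔮'`; re-base the invariant at `𝔮'`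
    have hI : ideal P φ 𝔭 ≤ 𝔔'.comap (algebraMap A (blowupAlgebra (Ideal.span ((fun q : Q => χ (Multiplicative.ofAdd q)) '' {q : Q | (q : Fin n → ℤ) ∈ s})) (χ (Multiplicative.ofAdd ⟨h, hhQ⟩)))) := by
      intro a ha
      rw [← h𝔮'C, Ideal.mem_comap]
      apply hJ
      rw [hJeq]
      exact ChartAlgebraFixedPointDim.map_ideal_le_ideal hPQ hχ h𝔓A (Ideal.mem_map_of_mem _ ha)
    have hface : faceMonoid P φ (𝔔'.comap (algebraMap A (blowupAlgebra (Ideal.span ((fun q : Q => χ (Multiplicative.ofAdd q)) '' {q : Q | (q : Fin n → ℤ) ∈ s})) (χ (Multiplicative.ofAdd ⟨h, hhQ⟩))))) = faceMonoid P φ 𝔭 :=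
      FixedStratumNearby.faceMonoid_eq_of_ideal_le_of_forall_not_mem hI hFunit
    have hreg𝔮 : IsLogRegularAt P φ (𝔔'.comap (algebraMap A (blowupAlgebra (Ideal.span ((fun q : Q => χ (Multiplicative.ofAdd q)) '' {q : Q | (q : Fin n → ℤ) ∈ s})) (χ (Multiplicative.ofAdd ⟨h, hhQ⟩))))) := hregY _ le_rfl
    have hreg𝔮' : ∀ (𝔮 : Ideal A) [𝔮.IsPrime], 𝔮 ≤ 𝔔'.comap (algebraMap A (blowupAlgebra (Ideal.span ((fun q : Q => χ (Multiplicative.ofAdd q)) '' {q : Q | (q : Fin n → ℤ) ∈ s})) (χ (Multiplicative.ofAdd ⟨h, hhQ⟩)))) →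
        ideal P φ (𝔔'.comap (algebraMap A (blowupAlgebra (Ideal.span ((fun q : Q => χ (Multiplicative.ofAdd q)) '' {q : Q | (q : Fin n → ℤ) ∈ s})) (χ (Multiplicative.ofAdd ⟨h, hhQ⟩))))) ≤ 𝔮 → IsLogRegularAt P φ 𝔮 :=
      fun 𝔮 _ hle _ => hregY 𝔮 hle
    have hrank' : n - Module.finrank ℤ (Submodule.span ℤ
        (faceMonoid P φ (𝔔'.comap (algebraMap A (blowupAlgebra (Ideal.span ((fun q : Q => χ (Multiplicative.ofAdd q)) '' {q : Q | (q : Fin n → ℤ) ∈ s})) (χ (Multiplicative.ofAdd ⟨h, hhQ⟩))))) : Set (Fin n → ℤ))) ≤ 2 := by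
      rw [hface]; exact hrank
    obtain ⟨𝔓h, h𝔓hprime, h𝔓hA, h𝔓hq, -, hsing', hregother', hχ₂, hgen₂, -, -, -, -, -, -, -⟩ :=
      FixedStratumNextRound.exists_fixedPrime_package_of_stratum (𝔭 := 𝔔'.comap (algebraMap A (blowupAlgebra (Ideal.span ((fun q : Q => χ (Multiplicative.ofAdd q)) '' {q : Q | (q : Fin n → ℤ) ∈ s})) (χ (Multiplicative.ofAdd ⟨h, hhQ⟩))))) hc hs hP
        hsat hspanP hreg𝔮 hreg𝔮' hrank' hPQ hχ hgen hD hK hΩ hQfg hhQ (by rw [hface]; exact hQh)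
        (by rw [hface]; exact hind) (by rw [hface]; exact hspan)
    haveI := h𝔓hprime
    have hPQ₂ : P ≤ blowupChartMonoid Q {q : Q | (q : Fin n → ℤ) ∈ s} ⟨h, hhQ⟩ := hPQ.trans (le_blowupChartMonoid Q _ ⟨h, hhQ⟩)
    constructor
    · -- singular ⇒ `𝔔'` is THE fixed prime over `𝔮'`
      intro hsing qq hqq
      by_contra hnot
      apply hsing
      apply hregother' 𝔔' rfl
      intro heq
      rw [heq] at hnot
      exact hnot ((h𝔓hq qq).2 (by rw [hface]; exact hqq))
    · intro hall
      have heq : 𝔓h = 𝔔' :=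
        eq_of_comap_eq_of_forall_mem (𝔭 := 𝔔'.comap (algebraMap A (blowupAlgebra (Ideal.span ((fun q : Q => χ (Multiplicative.ofAdd q)) '' {q : Q | (q : Fin n → ℤ) ∈ s})) (χ (Multiplicative.ofAdd ⟨h, hhQ⟩))))) hPQ₂ hχ₂ hgen₂ h𝔓hA rfl
          (fun q hq => (h𝔓hq q).2 hq) (fun q hq => hall q (by rw [← hface]; exact hq))
      subst heq
      exact hsing'
  · -- OFF the exceptional divisor: both sides fail
    have hreg₀ : IsRegularLocalRing (Localization.AtPrime (𝔔'.comap (algebraMap C (blowupAlgebra (Ideal.span ((fun q : Q => χ (Multiplicative.ofAdd q)) '' {q : Q | (q : Fin n → ℤ) ∈ s})) (χ (Multiplicative.ofAdd ⟨h, hhQ⟩)))))) := by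
      by_contra hn
      exact hJ (hJeq.le.trans (hSing₀.mp hn))
    have hreg' : IsRegularLocalRing (Localization.AtPrime 𝔔') := (hoff hJ).mpr hreg₀
    constructor
    · intro hsing; exact absurd hreg' hsing
    · intro hall
      exfalso
      apply hJ
      refine Ideal.span_le.2 ?_
      rintro _ ⟨q, hqS, rfl⟩
      rw [SetLike.mem_coe, Ideal.mem_comap, ← hext q]
      exact hall ⟨(q : Fin n → ℤ), le_blowupChartMonoid Q {q : Q | (q : Fin n → ℤ) ∈ s} ⟨h, hhQ⟩ q.2⟩ (hsL _ hqS)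

omit [IsNoetherianRing A] [IsNoetherianRing C] in
/-- **The conclusion is literally the next round's `hSing`**: for the new fixed prime `𝔔` of `C_h` (over `𝔭`, containing
`χ_h(Q_h ∖ ℤF_𝔭)`), `χ_h(Q_h ∖ ℤF_𝔭) ⊆ 𝔔'` iff Kato's ideal `I(𝔔, χ_h)` is contained in `𝔔'`.
[cite: Kato1994, Def. (2.1), (10.1)] -/
theorem forall_mem_iff_ideal_le (hPQ : P ≤ Q)
    (hχ : ∀ p : P, χ (Multiplicative.ofAdd ⟨(p : Fin n → ℤ), hPQ p.2⟩) =
      algebraMap A C (φ (Multiplicative.ofAdd p)))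
    (hhQ : h ∈ Q)
    (𝔔 : Ideal (blowupAlgebra (Ideal.span ((fun q : Q => χ (Multiplicative.ofAdd q)) ''
        {q : Q | (q : Fin n → ℤ) ∈ s})) (χ (Multiplicative.ofAdd ⟨h, hhQ⟩)))) [𝔔.IsPrime]
    (h𝔔A : 𝔔.comap (algebraMap A _) = 𝔭)
    (h𝔔q : ∀ qq : blowupChartMonoid Q {q : Q | (q : Fin n → ℤ) ∈ s} ⟨h, hhQ⟩,
      (qq : Fin n → ℤ) ∉ Submodule.span ℤ (faceMonoid P φ 𝔭 : Set (Fin n → ℤ)) →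
        blowupChart Q χ {q : Q | (q : Fin n → ℤ) ∈ s} ⟨h, hhQ⟩ (Multiplicative.ofAdd qq) ∈ 𝔔)
    (𝔔' : Ideal (blowupAlgebra (Ideal.span ((fun q : Q => χ (Multiplicative.ofAdd q)) ''
        {q : Q | (q : Fin n → ℤ) ∈ s})) (χ (Multiplicative.ofAdd ⟨h, hhQ⟩)))) :
    (∀ qq : blowupChartMonoid Q {q : Q | (q : Fin n → ℤ) ∈ s} ⟨h, hhQ⟩,
        (qq : Fin n → ℤ) ∉ Submodule.span ℤ (faceMonoid P φ 𝔭 : Set (Fin n → ℤ)) →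
          blowupChart Q χ {q : Q | (q : Fin n → ℤ) ∈ s} ⟨h, hhQ⟩ (Multiplicative.ofAdd qq) ∈ 𝔔') ↔
      ideal (blowupChartMonoid Q {q : Q | (q : Fin n → ℤ) ∈ s} ⟨h, hhQ⟩)
          (blowupChart Q χ {q : Q | (q : Fin n → ℤ) ∈ s} ⟨h, hhQ⟩) 𝔔 ≤ 𝔔' := by
  have hχ₂ := tower_chi hPQ hχ (le_blowupChartMonoid Q {q : Q | (q : Fin n → ℤ) ∈ s} ⟨h, hhQ⟩)
    (blowupChart_of_mem Q χ {q : Q | (q : Fin n → ℤ) ∈ s} ⟨h, hhQ⟩)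
  have hiff := not_mem_iff_mem_span_of_comap_eq
    (hPQ.trans (le_blowupChartMonoid Q {q : Q | (q : Fin n → ℤ) ∈ s} ⟨h, hhQ⟩)) hχ₂ h𝔔A h𝔔q
  constructor
  · intro hall
    rw [ideal]
    refine Ideal.span_le.2 ?_
    rintro _ ⟨qq, hqq, rfl⟩
    refine hall qq fun hL => ?_
    exact ((hiff qq).2 hL) hqq
  · intro hle qq hqq
    exact hle (Ideal.subset_span ⟨qq, h𝔔q qq hqq, rfl⟩)

end Summit.ResolutionOfSingularities.ResolutionOfSingularities.Theorems.FRationalResolution.SingBlowupRoundSing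

end
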